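import Literature.AlgebraicGeometry.Resolution.ArithmeticalThreefoldsMonomials
import Literature.AlgebraicGeometry.Resolution.ArithmeticalThreefoldsClosedPoints
import HarnessLib

/-!
# Cossart–Piltant 2019, Prop. 4.8: reduction of the descent leaf to its geometric head

Topic: `Literature/AlgebraicGeometry/Resolution` (proofs only; no new notions, no new named
facts). The named fact `CossartPiltant2019LU3OfComplete` (`ArithmeticalThreefolds.lean`) is
journal Prop. 4.8 = arXiv v1 Prop. 4.6 of

* V. Cossart, O. Piltant, *Resolution of singularities of arithmetical threefolds*, J. Algebra
  529 (2019) 268–535 = arXiv:1412.0868 (v1, pp. 52–53):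

"Assume that (LU) holds for every complete local domain of dimension three. Then theorem 1.1
holds." Its printed proof descends (LU) from the formal completion `Â` of a local domain `A` to
`A` along a valuation `v` of `K = QF(A)`: extend `v` to `v̂` on `K̂₁ = QF(Â/P̂₁)` (`P̂₁` a minimal
prime of the reduced ring `Â`); take a resolution `Ŷ → Spec Â` (Thm. 1.1 for `Spec Â`, by the
hypothesis and patching, journal Prop. 4.6) and the centre `ŷ` of `v̂` on it; arrange by
Lemma 4.7 (= [CoP1] Prop. 6.2 with embedded resolution of surfaces) and the density of `A` in `Â`
((511)–(512)) that a regular system of parameters `(û₁, …, û_r, u'_{r+1}, …, u'_d)` of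
`𝒪_{Ŷ,ŷ}` satisfies `g_j = (unit) · û_j^a ∈ 𝒪_{Ŷ,ŷ} ∩ K`; then ("We now conclude the proof …",
p. 53) the integral closure `T` of `A[g₁, …, g_d]` is the sought finitely generated algebra,
`T_P` being regular by EGA IV 7.9.3.1, normality of `T'_{P'}` and Zariski's Main Theorem.

Everything in this proof EXCEPT the construction of `𝒪_{Ŷ,ŷ}` with its regular system of
parameters and the `g_j` is proved in the tree (`ValuationExtensionToCompletion.lean`,
`FormalEquidimensionality.lean`, `RegularHomReduced.lean`, `IntegralClosureEssFiniteType.lean`,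
`NormalAscent(Completion).lean`, `NormalBirationalQuasiFinite.lean`,
`ArithmeticalThreefoldsDescentTail.lean`, `ArithmeticalThreefoldsAlgebraization.lean`,
`ArithmeticalThreefoldsMonomials.lean`, and the reductions of
`ArithmeticalThreefoldsClosedPoints.lean`). This file ASSEMBLES these pieces into one PROVED
reduction statement, making the remaining GEOMETRIC HEAD of the printed proof explicit:

* `exists_adjoin_isRegularLocalRing_of_headData` — the conclusion of (LU) for `A` at `v` from the
  head's output over an abstract presentation `K̂₁` of `QF(Â/P̂₁)` (residue algebraicity of
  `𝒪_{Ŷ,ŷ}` over `A` is derived from that of `𝒪_v̂` over `Â`,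
  `exists_eval₂_mem_maximalIdeal_of_valuation_adicCompletion`);
* `cpLocalUniformization_of_head` — **(LU) for a Noetherian local domain `A` essentially of
  finite type over a field holds as soon as the head holds for `A`**: for every valuation ring
  `O = 𝒪_v` of `K` as in (LU), every field `K̂₁` under `Â` with kernel a minimal prime and
  `K̂₁ = QF(Â/P̂₁)`, every embedding `ι : K → K̂₁` over `A`, and every valuation ring `O' = 𝒪_v̂`
  of `K̂₁` containing and dominating `Â` with residue field algebraic over that of `Â` and
  `O' ∩ K = O` — ALL OF WHICH EXIST (`exists_minimalPrime_valuationSubring_adicCompletion`,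
  instantiated here on `K̂₁ := FractionRing (Â ⧸ P̂₁)` with `ι` from `IsFractionRing.lift`) —
  the head must produce a regular local ring `S` (`= 𝒪_{Ŷ,ŷ}`) essentially of finite type over
  `Â`, dominating `Â`, embedded in `K̂₁` over `Â`, contained in and dominated by `O'`, together
  with generators `z₁, …, z_d` of `𝔪_S`, exponents `a_j ≥ 1`, units `c_j` and elements
  `g_j ∈ K` with `ι(g_j) = c_j z_j^{a_j}` (the output of Lemma 4.7 with (511)–(512); (511)
  itself is `IsRsopPart.exists_prod_zpow_eq_units_mul_pow_of_comap`);
* `CossartPiltant2019LU3OfComplete.of_head` — hence **`CossartPiltant2019LU3OfComplete` follows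
  from `CossartJannsenSaito2020` (surface resolution, the input [L3] of the patching
  Prop. 4.6 used for the reductions to closed points of three-dimensional models,
  `ArithmeticalThreefoldsClosedPoints.lean`) and the head for the local rings `B_𝔭` (`B` a
  domain of finite type over a field, `𝔭` maximal, `dim B = dim B_𝔭 = 3`), the head being allowed
  to use the hypothesis `CossartPiltant2019LUComplete3`** (which applies to every formal branch
  `Â/P̂` of such `B_𝔭`, `CossartPiltant2019LUComplete3.cpLocalUniformization_of_surjective`).

What the head still contains of the source: Thm. 1.1 for `Spec Â` (journal Prop. 4.6, Zariski
patching, from (LU) for the `Â/P̂ᵢ` and [L3]), Lemma 4.7 = [CoP1] Prop. 6.2 (with Prop. 4.2,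
embedded resolution of surfaces), and the density step (5101)–(5102).

## Sources

* V. Cossart, O. Piltant, J. Algebra 529 (2019) 268–535 = arXiv:1412.0868, proof of Prop. 4.8
  (v1: Prop. 4.6, pp. 52–53). [CossartPiltant2019]
-/

noncomputable section

namespace Literature.AlgebraicGeometry.Resolution

universe u

open IsLocalRing

section HeadData

variable {A : Type u} [CommRing A] [IsDomain A] [IsLocalRing A] [IsNoetherianRing A]
  {K : Type u} [Field K] [Algebra A K] [IsFractionRing A K]

/-- **The conclusion of (LU) for `A` at `v` from the output of the geometric head** (abstract
presentation `K̂₁` of `QF(Â/P̂₁)`, `ι : K → K̂₁` over `A`). Data: `A` a Noetherian local domain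
essentially of finite type over a field `k`; `K̂₁` a field under `Â` with kernel a minimal prime
and `K̂₁ = QF(Â/P̂₁)`; `ι : K → K̂₁` compatible with `A → Â → K̂₁`; a valuation ring `O'` of `K̂₁`
(`= 𝒪_v̂`) with residue field algebraic over that of `Â` (elementary form) and `O' ∩ K = O`; a
regular local ring `S` (`= 𝒪_{Ŷ,ŷ}`) essentially of finite type over `Â`, dominating `Â`,
embedded in `K̂₁` over `Â`, contained in and dominated by `O'`; generators `z_j` of `𝔪_S`,
exponents `a_j ≥ 1`, units `c_j ∈ Sˣ` and `g_j ∈ K` with `ι(g_j) = c_j z_j^{a_j}`. Conclusion: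
a finitely generated `A[t] ⊆ 𝒪_v = O` regular at the centre of `v`
(`exists_adjoin_isRegularLocalRing_of_rsp_powers`, with the residue algebraicity of `S` over
`A` supplied by `exists_eval₂_mem_maximalIdeal_of_valuation_adicCompletion`).
[cite: CossartPiltant2019, proof of Prop. 4.8 (arXiv v1: Prop. 4.6, p. 53)] -/
theorem exists_adjoin_isRegularLocalRing_of_headData
    (k : Type u) [Field k] [Algebra k A] [Algebra.EssFiniteType k A]
    {K₁ : Type u} [Field K₁] [Algebra (AdicCompletion (maximalIdeal A) A) K₁]
    (hP₁ : RingHom.ker (algebraMap (AdicCompletion (maximalIdeal A) A) K₁) ∈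
      minimalPrimes (AdicCompletion (maximalIdeal A) A))
    (hK₁ : ∀ z : K₁, ∃ a b : AdicCompletion (maximalIdeal A) A,
      z = algebraMap _ K₁ a / algebraMap _ K₁ b)
    (ι : K →+* K₁) (hι : ι.comp (algebraMap A K) =
      (algebraMap (AdicCompletion (maximalIdeal A) A) K₁).comp
        (algebraMap A (AdicCompletion (maximalIdeal A) A)))
    (O' : ValuationSubring K₁)
    (halgO' : ∀ y : O', ∃ p : Polynomial (AdicCompletion (maximalIdeal A) A),
      (∃ i, p.coeff i ∉ (maximalIdeal A).map (algebraMap A (AdicCompletion (maximalIdeal A) A))) ∧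
      O'.valuation (p.eval₂ (algebraMap (AdicCompletion (maximalIdeal A) A) K₁) y) < 1)
    (O : ValuationSubring K) (hO : O'.comap ι = O)
    -- the head's output
    {S : Type u} [CommRing S] [IsRegularLocalRing S]
    [Algebra (AdicCompletion (maximalIdeal A) A) S]
    [IsLocalHom (algebraMap (AdicCompletion (maximalIdeal A) A) S)]
    [Algebra.EssFiniteType (AdicCompletion (maximalIdeal A) A) S] [Algebra S K₁]
    [IsScalarTower (AdicCompletion (maximalIdeal A) A) S K₁]
    (hSK₁ : Function.Injective (algebraMap S K₁))
    (hSO' : ∀ s : S, algebraMap S K₁ s ∈ O')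
    (hdomS : ∀ s ∈ maximalIdeal S, O'.valuation (algebraMap S K₁ s) < 1)
    {d : ℕ} (z : Fin d → S) (hz : Ideal.span (Set.range z) = maximalIdeal S)
    (a : Fin d → ℕ) (ha : ∀ j, 0 < a j) (c : Fin d → Sˣ) (g : Fin d → K)
    (hg : ∀ j, ι (g j) = algebraMap S K₁ (c j * z j ^ a j)) :
    ∃ (t : Finset K) (h : (Algebra.adjoin A (t : Set K)).toSubring ≤ O.toSubring),
      IsRegularLocalRing (Localization.AtPrime
        (Ideal.comap (Subring.inclusion h) (maximalIdeal O))) := by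
  set Ah := AdicCompletion (maximalIdeal A) A with hAhdef
  -- the `A`-algebra structures on `K̂₁`, `S` and the `K`-algebra structure on `K̂₁` given by `ι`
  letI : Algebra A K₁ := ((algebraMap Ah K₁).comp (algebraMap A Ah)).toAlgebra
  haveI : IsScalarTower A Ah K₁ := IsScalarTower.of_algebraMap_eq fun _ => rfl
  letI : Algebra K K₁ := ι.toAlgebra
  haveI : IsScalarTower A K K₁ :=
    IsScalarTower.of_algebraMap_eq fun x => (RingHom.congr_fun hι x).symm
  letI : Algebra A S := ((algebraMap Ah S).comp (algebraMap A Ah)).toAlgebra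
  haveI : IsScalarTower A Ah S := IsScalarTower.of_algebraMap_eq fun _ => rfl
  -- residue algebraicity of `S` over `A` (`𝔪_Â = 𝔪_A Â`)
  have halgO'' : ∀ y : O', ∃ p : Polynomial Ah, (∃ i, p.coeff i ∉ maximalIdeal Ah) ∧
      O'.valuation (p.eval₂ (algebraMap Ah K₁) y) < 1 := fun y => by
    obtain ⟨p, ⟨i, hi⟩, hlt⟩ := halgO' y
    exact ⟨p, ⟨i, by rwa [AdicCompletion.maximalIdeal_eq_map]⟩, hlt⟩
  have halg : ∀ x : S, ∃ p : Polynomial A, (∃ i, p.coeff i ∉ maximalIdeal A) ∧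
      p.eval₂ (algebraMap A S) x ∈ maximalIdeal S :=
    exists_eval₂_mem_maximalIdeal_of_valuation_adicCompletion O' hSO' hdomS halgO''
  exact exists_adjoin_isRegularLocalRing_of_rsp_powers k hP₁ hK₁ hSK₁ halg O' hSO' hdomS O hO z
    hz a ha c g hg

/-- **(LU) for `A` from the geometric head of Cossart–Piltant's proof of Prop. 4.8.** Let `A`
be a Noetherian local domain essentially of finite type over a field `k`, with fraction field
`K` and completion `Â`. Suppose that for every valuation ring `O` of `K` as in (LU) (containing
and dominating `A`, residue field algebraic over that of `A`), every field `K̂₁` under `Â` whose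
kernel is a minimal prime `P̂₁` with `K̂₁ = QF(Â/P̂₁)`, every embedding `ι : K → K̂₁` over `A`, and
every valuation ring `O'` of `K̂₁` containing and dominating `Â`, with residue field algebraic
over that of `Â` and `O' ∩ K = O` (such data exist:
`exists_minimalPrime_valuationSubring_adicCompletion`), there is a regular local ring `S`
essentially of finite type over `Â`, dominating `Â`, embedded in `K̂₁` over `Â`, contained in and
dominated by `O'`, with generators `z₁, …, z_d` of `𝔪_S`, exponents `a_j ≥ 1`, units `c_j` and
elements `g_j ∈ K` with `ι(g_j) = c_j z_j^{a_j}` — in the source: `S = 𝒪_{Ŷ,ŷ}` for the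
resolution `Ŷ → Spec Â` and the centre `ŷ` of `v̂`, `(z_j) = (û₁, …, û_r, u'_{r+1}, …, u'_d)` by
Lemma 4.7 and (511)–(512). Then `A` has Cossart–Piltant's property (LU)
(`CPLocalUniformization A`). Proof: extend `v` to `K̂₁ := QF(Â/P̂₁)` (Step
`exists_minimalPrime_valuationSubring_adicCompletion`, with `ι` the extension of
`A → Â → Â/P̂₁ → K̂₁` to `K`), feed the head, and conclude by
`exists_adjoin_isRegularLocalRing_of_headData`.
[cite: CossartPiltant2019, proof of Prop. 4.8 (arXiv v1: Prop. 4.6, pp. 52–53)] -/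
theorem cpLocalUniformization_of_head (k : Type u) [Field k] [Algebra k A]
    [Algebra.EssFiniteType k A]
    (head : ∀ (K : Type u) [Field K] [Algebra A K] [IsFractionRing A K] (O : ValuationSubring K),
      (∀ x : A, algebraMap A K x ∈ O) →
      (∀ x ∈ maximalIdeal A, O.valuation (algebraMap A K x) < 1) →
      (∀ y : O, ∃ p : Polynomial A, (∃ i, p.coeff i ∉ maximalIdeal A) ∧
        O.valuation (p.eval₂ (algebraMap A K) y) < 1) →
      ∀ (K₁ : Type u) [Field K₁] [Algebra (AdicCompletion (maximalIdeal A) A) K₁],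
      RingHom.ker (algebraMap (AdicCompletion (maximalIdeal A) A) K₁) ∈
        minimalPrimes (AdicCompletion (maximalIdeal A) A) →
      (∀ z : K₁, ∃ a b : AdicCompletion (maximalIdeal A) A,
        z = algebraMap _ K₁ a / algebraMap _ K₁ b) →
      ∀ (ι : K →+* K₁), ι.comp (algebraMap A K) =
        (algebraMap (AdicCompletion (maximalIdeal A) A) K₁).comp
          (algebraMap A (AdicCompletion (maximalIdeal A) A)) →
      ∀ (O' : ValuationSubring K₁),
      (∀ x : AdicCompletion (maximalIdeal A) A, algebraMap _ K₁ x ∈ O') →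
      (∀ x ∈ (maximalIdeal A).map (algebraMap A (AdicCompletion (maximalIdeal A) A)),
        O'.valuation (algebraMap _ K₁ x) < 1) →
      (∀ y : O', ∃ p : Polynomial (AdicCompletion (maximalIdeal A) A),
        (∃ i, p.coeff i ∉
          (maximalIdeal A).map (algebraMap A (AdicCompletion (maximalIdeal A) A))) ∧
        O'.valuation (p.eval₂ (algebraMap (AdicCompletion (maximalIdeal A) A) K₁) y) < 1) →
      O'.comap ι = O →
      ∃ (S : Type u) (_ : CommRing S) (_ : IsRegularLocalRing S)
        (_ : Algebra (AdicCompletion (maximalIdeal A) A) S) (_ : Algebra S K₁),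
        IsLocalHom (algebraMap (AdicCompletion (maximalIdeal A) A) S) ∧
        Algebra.EssFiniteType (AdicCompletion (maximalIdeal A) A) S ∧
        IsScalarTower (AdicCompletion (maximalIdeal A) A) S K₁ ∧
        Function.Injective (algebraMap S K₁) ∧
        (∀ s : S, algebraMap S K₁ s ∈ O') ∧
        (∀ s ∈ maximalIdeal S, O'.valuation (algebraMap S K₁ s) < 1) ∧
        ∃ (d : ℕ) (z : Fin d → S) (a : Fin d → ℕ) (c : Fin d → Sˣ) (g : Fin d → K),
          Ideal.span (Set.range z) = maximalIdeal S ∧ (∀ j, 0 < a j) ∧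
          ∀ j, ι (g j) = algebraMap S K₁ (c j * z j ^ a j)) :
    CPLocalUniformization A := by
  intro K _ _ _ O hAO hdom halg
  set Ah := AdicCompletion (maximalIdeal A) A with hAhdef
  -- Step A: a minimal prime `P` of `Â` with `P ∩ A = 0` carrying an extension of `v`
  obtain ⟨P, hPmin, hPA, H⟩ :=
    exists_minimalPrime_valuationSubring_adicCompletion.{u, u, u} O hAO hdom halg
  haveI hPprime : P.IsPrime := hPmin.1.1
  -- `R := Â/P`, `K̂₁ := QF(R)`
  haveI : IsLocalRing (Ah ⧸ P) :=
    IsLocalRing.of_surjective' (Ideal.Quotient.mk P) Ideal.Quotient.mk_surjective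
  haveI : IsLocalHom (Ideal.Quotient.mk P) :=
    IsLocalHom.of_surjective _ Ideal.Quotient.mk_surjective
  set K₁ := FractionRing (Ah ⧸ P) with hK₁def
  have hRK₁ : Function.Injective (algebraMap (Ah ⧸ P) K₁) := IsFractionRing.injective _ _
  have halgmap : ∀ x : Ah, algebraMap Ah K₁ x = algebraMap (Ah ⧸ P) K₁ (Ideal.Quotient.mk P x) :=
    fun x => IsScalarTower.algebraMap_apply Ah (Ah ⧸ P) K₁ x
  -- the kernel of `Â → K̂₁` is `P`
  have hker : RingHom.ker (algebraMap Ah K₁) = P := by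
    ext x
    rw [RingHom.mem_ker, halgmap, map_eq_zero_iff _ hRK₁, Ideal.Quotient.eq_zero_iff_mem]
  have hP₁ : RingHom.ker (algebraMap Ah K₁) ∈ minimalPrimes Ah := by
    rw [hker]
    exact hPmin
  -- `K̂₁` consists of fractions of elements of `Â`
  have hK₁ : ∀ z : K₁, ∃ a b : Ah, z = algebraMap _ K₁ a / algebraMap _ K₁ b := by
    intro z
    obtain ⟨a, b, -, rfl⟩ := IsFractionRing.div_surjective (A := Ah ⧸ P) z
    obtain ⟨a', rfl⟩ := Ideal.Quotient.mk_surjective a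
    obtain ⟨b', rfl⟩ := Ideal.Quotient.mk_surjective b
    exact ⟨a', b', by rw [halgmap, halgmap]⟩
  -- the embedding `ι : K → K̂₁` extending `A → Â → Â/P → K̂₁` (injective as `P ∩ A = 0`)
  have hinjA : Function.Injective ((algebraMap Ah K₁).comp (algebraMap A Ah)) := by
    rw [injective_iff_map_eq_zero]
    intro x hx
    rw [RingHom.comp_apply] at hx
    have h1 : algebraMap A Ah x ∈ RingHom.ker (algebraMap Ah K₁) := RingHom.mem_ker.mpr hx
    rw [hker] at h1
    have h2 : x ∈ P.comap (algebraMap A Ah) := Ideal.mem_comap.mpr h1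
    rwa [hPA, Ideal.mem_bot] at h2
  obtain ⟨ι, hι⟩ : ∃ ι : K →+* K₁,
      ι.comp (algebraMap A K) = (algebraMap Ah K₁).comp (algebraMap A Ah) :=
    ⟨IsFractionRing.lift hinjA, RingHom.ext fun x => by
      rw [RingHom.comp_apply, RingHom.comp_apply]
      exact IsFractionRing.lift_algebraMap hinjA x⟩
  have hιH : ι.comp (algebraMap A K) =
      (algebraMap (Ah ⧸ P) K₁).comp ((Ideal.Quotient.mk P).comp (algebraMap A Ah)) := by
    rw [hι]
    refine RingHom.ext fun x => ?_
    rw [RingHom.comp_apply, RingHom.comp_apply, RingHom.comp_apply]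
    exact halgmap _
  -- Step A's valuation ring `O'` of `K̂₁`
  obtain ⟨O', hRO', hdomR, halgR, hcomap⟩ := H (Ah ⧸ P) (Ideal.Quotient.mk P)
    Ideal.Quotient.mk_surjective Ideal.mk_ker K₁ hRK₁ ι hιH
  -- its properties in terms of `Â` (`𝔪_A Â ⊆ 𝔪_Â` maps into `𝔪_{Â/P}`)
  have hmR : ∀ x ∈ (maximalIdeal A).map (algebraMap A Ah),
      Ideal.Quotient.mk P x ∈ maximalIdeal (Ah ⧸ P) := fun x hx => by
    rw [← AdicCompletion.maximalIdeal_eq_map] at hx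
    exact (IsLocalRing.mem_maximalIdeal _).mpr fun hu =>
      ((IsLocalRing.mem_maximalIdeal x).mp hx) ((isUnit_map_iff (Ideal.Quotient.mk P) x).mp hu)
  have hRO'' : ∀ x : Ah, algebraMap Ah K₁ x ∈ O' := fun x => by
    rw [halgmap]
    exact hRO' _
  have hdom'' : ∀ x ∈ (maximalIdeal A).map (algebraMap A Ah),
      O'.valuation (algebraMap Ah K₁ x) < 1 := fun x hx => by
    rw [halgmap]
    exact hdomR _ (hmR x hx)
  have hcompR : (algebraMap (Ah ⧸ P) K₁).comp (Ideal.Quotient.mk P) = algebraMap Ah K₁ :=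
    RingHom.ext fun x => (halgmap x).symm
  have halg'' : ∀ y : O', ∃ p : Polynomial Ah,
      (∃ i, p.coeff i ∉ (maximalIdeal A).map (algebraMap A Ah)) ∧
      O'.valuation (p.eval₂ (algebraMap Ah K₁) y) < 1 := by
    intro y
    obtain ⟨p, ⟨i, hi⟩, hlt⟩ := halgR y
    obtain ⟨q, rfl⟩ :=
      Polynomial.map_surjective (Ideal.Quotient.mk P) Ideal.Quotient.mk_surjective p
    refine ⟨q, ⟨i, fun hqi => hi ?_⟩, ?_⟩
    · rw [Polynomial.coeff_map]
      exact hmR _ hqi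
    · rwa [Polynomial.eval₂_map, hcompR] at hlt
  -- the head
  obtain ⟨S, _, _, _, _, hloc, hess, htower, hSK₁, hSO', hdomS, d, z, a, c, g, hz, ha, hg⟩ :=
    head K O hAO hdom halg K₁ hP₁ hK₁ ι hι O' hRO'' hdom'' halg'' hcomap
  haveI := hloc
  haveI := hess
  haveI := htower
  exact exists_adjoin_isRegularLocalRing_of_headData k hP₁ hK₁ ι hι O' halg'' O hcomap hSK₁ hSO'
    hdomS z hz a ha c g hg

end HeadData

/-! ## The hypothesis of Prop. 4.8 on the formal branch carrying `v̂`, in the head's format -/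

/-- **"By assumption in this proposition" at `v̂`.** In the situation handed to the head by
`CossartPiltant2019LU3OfComplete.of_head` — `A = B_𝔭` of dimension three, a field `K̂₁` under
`Â` whose kernel `P̂₁` is a minimal prime with `K̂₁ = QF(Â/P̂₁)`, and a valuation ring
`O' = 𝒪_v̂` of `K̂₁` containing `Â`, dominating it, with residue field algebraic over that of `Â` —
the hypothesis `CossartPiltant2019LUComplete3` applies to the complete local domain `Â/P̂₁` of
dimension three (`CossartPiltant2019LUComplete3.cpLocalUniformization_of_surjective`) at `v̂`:
there is a finite `s ⊆ K̂₁` with `Â[s] ⊆ 𝒪_v̂` (the image of `Â` in `K̂₁` is `Â/P̂₁`) whose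
localization at the centre of `v̂` is regular — a local uniformization of `v̂` over the formal
branch. (In the source the head uses much more: Thm. 1.1 for all of `Spec Â`, by patching.)
[cite: CossartPiltant2019, proof of Prop. 4.8 (arXiv v1: Prop. 4.6, p. 53)] -/
theorem CossartPiltant2019LUComplete3.exists_adjoin_isRegularLocalRing_of_valuationSubring
    (hc : CossartPiltant2019LUComplete3.{u}) {k B : Type u} [Field k] [CommRing B] [IsDomain B]
    [Algebra k B] [Algebra.FiniteType k B] (p : Ideal B) [p.IsPrime]
    (hdim : ringKrullDim (Localization.AtPrime p) = 3)
    {K₁ : Type u} [Field K₁]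
    [Algebra (AdicCompletion (maximalIdeal (Localization.AtPrime p)) (Localization.AtPrime p)) K₁]
    (hP₁ : RingHom.ker (algebraMap (AdicCompletion (maximalIdeal (Localization.AtPrime p))
        (Localization.AtPrime p)) K₁) ∈
      minimalPrimes (AdicCompletion (maximalIdeal (Localization.AtPrime p))
        (Localization.AtPrime p)))
    (hK₁ : ∀ z : K₁, ∃ a b : AdicCompletion (maximalIdeal (Localization.AtPrime p))
        (Localization.AtPrime p), z = algebraMap _ K₁ a / algebraMap _ K₁ b)
    (O' : ValuationSubring K₁)
    (hRO' : ∀ x : AdicCompletion (maximalIdeal (Localization.AtPrime p)) (Localization.AtPrime p),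
      algebraMap _ K₁ x ∈ O')
    (hdom' : ∀ x ∈ (maximalIdeal (Localization.AtPrime p)).map (algebraMap (Localization.AtPrime p)
        (AdicCompletion (maximalIdeal (Localization.AtPrime p)) (Localization.AtPrime p))),
      O'.valuation (algebraMap _ K₁ x) < 1)
    (halg' : ∀ y : O', ∃ q : Polynomial (AdicCompletion (maximalIdeal (Localization.AtPrime p))
        (Localization.AtPrime p)),
      (∃ i, q.coeff i ∉ (maximalIdeal (Localization.AtPrime p)).map
        (algebraMap (Localization.AtPrime p)
          (AdicCompletion (maximalIdeal (Localization.AtPrime p)) (Localization.AtPrime p)))) ∧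
      O'.valuation (q.eval₂ (algebraMap _ K₁) y) < 1) :
    ∃ (s : Finset K₁) (h : (Algebra.adjoin (AdicCompletion (maximalIdeal (Localization.AtPrime p))
        (Localization.AtPrime p)) (s : Set K₁)).toSubring ≤ O'.toSubring),
      IsRegularLocalRing (Localization.AtPrime
        (Ideal.comap (Subring.inclusion h) (maximalIdeal O'))) := by
  set A := Localization.AtPrime p with hAdef
  haveI : IsNoetherianRing B := Algebra.FiniteType.isNoetherianRing k B
  haveI : IsNoetherianRing A := IsLocalization.isNoetherianRing p.primeCompl _ inferInstance
  set Ah := AdicCompletion (maximalIdeal A) A with hAhdef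
  set P : Ideal Ah := RingHom.ker (algebraMap Ah K₁) with hPdef
  haveI hPprime : P.IsPrime := hP₁.1.1
  -- `R := Â/P` with fraction field `K̂₁`
  haveI : IsLocalRing (Ah ⧸ P) :=
    IsLocalRing.of_surjective' (Ideal.Quotient.mk P) Ideal.Quotient.mk_surjective
  haveI : IsLocalHom (Ideal.Quotient.mk P) :=
    IsLocalHom.of_surjective _ Ideal.Quotient.mk_surjective
  letI : Algebra (Ah ⧸ P) K₁ :=
    (Ideal.Quotient.lift P (algebraMap Ah K₁) fun a ha => (RingHom.mem_ker).mp ha).toAlgebra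
  have hlift : ∀ x : Ah, algebraMap (Ah ⧸ P) K₁ (Ideal.Quotient.mk P x) = algebraMap Ah K₁ x :=
    fun x => Ideal.Quotient.lift_mk P (algebraMap Ah K₁) _
  haveI : IsScalarTower Ah (Ah ⧸ P) K₁ := IsScalarTower.of_algebraMap_eq fun x => (hlift x).symm
  have hinj : Function.Injective (algebraMap (Ah ⧸ P) K₁) := by
    rw [injective_iff_map_eq_zero]
    intro r hr
    obtain ⟨x, rfl⟩ := Ideal.Quotient.mk_surjective r
    rw [hlift] at hr
    exact Ideal.Quotient.eq_zero_iff_mem.mpr ((RingHom.mem_ker).mpr hr)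
  haveI : FaithfulSMul (Ah ⧸ P) K₁ := (faithfulSMul_iff_algebraMap_injective _ K₁).mpr hinj
  haveI : IsFractionRing (Ah ⧸ P) K₁ := IsFractionRing.of_field (Ah ⧸ P) K₁ fun z => by
    obtain ⟨a, b, rfl⟩ := hK₁ z
    exact ⟨Ideal.Quotient.mk P a, Ideal.Quotient.mk P b, by rw [hlift, hlift]⟩
  -- (LU) for `Â/P`
  have hLU : CPLocalUniformization (Ah ⧸ P) :=
    hc.cpLocalUniformization_of_surjective (k := k) p hdim (Ideal.Quotient.mk P)
      Ideal.Quotient.mk_surjective (by rw [Ideal.mk_ker]; exact hP₁)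
  -- the hypotheses of (LU) at `O'`, over `Â/P`
  have hmR : ∀ x : Ah, Ideal.Quotient.mk P x ∈ maximalIdeal (Ah ⧸ P) →
      x ∈ (maximalIdeal A).map (algebraMap A Ah) := fun x hx => by
    rw [← AdicCompletion.maximalIdeal_eq_map]
    exact (IsLocalRing.mem_maximalIdeal _).mpr fun hu =>
      ((IsLocalRing.mem_maximalIdeal _).mp hx) (hu.map (Ideal.Quotient.mk P))
  have hRO'R : ∀ r : Ah ⧸ P, algebraMap (Ah ⧸ P) K₁ r ∈ O' := fun r => by
    obtain ⟨x, rfl⟩ := Ideal.Quotient.mk_surjective r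
    rw [hlift]
    exact hRO' x
  have hdomR : ∀ r ∈ maximalIdeal (Ah ⧸ P), O'.valuation (algebraMap (Ah ⧸ P) K₁ r) < 1 := by
    intro r hr
    obtain ⟨x, rfl⟩ := Ideal.Quotient.mk_surjective r
    rw [hlift]
    exact hdom' x (hmR x hr)
  have hcompR : (algebraMap (Ah ⧸ P) K₁).comp (Ideal.Quotient.mk P) = algebraMap Ah K₁ :=
    RingHom.ext hlift
  have halgR : ∀ y : O', ∃ q : Polynomial (Ah ⧸ P), (∃ i, q.coeff i ∉ maximalIdeal (Ah ⧸ P)) ∧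
      O'.valuation (q.eval₂ (algebraMap (Ah ⧸ P) K₁) y) < 1 := by
    intro y
    obtain ⟨q, ⟨i, hi⟩, hlt⟩ := halg' y
    refine ⟨q.map (Ideal.Quotient.mk P), ⟨i, fun hqi => hi ?_⟩, ?_⟩
    · rw [Polynomial.coeff_map] at hqi
      exact hmR _ hqi
    · rwa [Polynomial.eval₂_map, hcompR]
  obtain ⟨s, h, hreg⟩ := hLU K₁ O' hRO'R hdomR halgR
  -- `Â/P[s] = Â[s]` as subrings of `K̂₁` (both are generated by the image of `Â` and `s`)
  have hrange : Set.range (algebraMap (Ah ⧸ P) K₁) = Set.range (algebraMap Ah K₁) := by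
    ext y
    constructor
    · rintro ⟨r, rfl⟩
      obtain ⟨x, rfl⟩ := Ideal.Quotient.mk_surjective r
      exact ⟨x, (hlift x).symm⟩
    · rintro ⟨x, rfl⟩
      exact ⟨Ideal.Quotient.mk P x, hlift x⟩
  have heq : (Algebra.adjoin Ah (s : Set K₁)).toSubring =
      (Algebra.adjoin (Ah ⧸ P) (s : Set K₁)).toSubring := by
    rw [Algebra.adjoin_eq_ring_closure, Algebra.adjoin_eq_ring_closure, hrange]
  suffices H : ∀ (T : Subring K₁) (hT : T ≤ O'.toSubring),
      T = (Algebra.adjoin (Ah ⧸ P) (s : Set K₁)).toSubring →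
      IsRegularLocalRing (Localization.AtPrime
        (Ideal.comap (Subring.inclusion hT) (maximalIdeal O'))) from
    ⟨s, heq.le.trans h, H _ _ heq⟩
  intro T hT hTeq
  subst hTeq
  exact hreg

/-- **The descent leaf reduced to its geometric head.** `CossartPiltant2019LU3OfComplete`
(= `CossartPiltant2019LUComplete3 → CossartPiltant2019LU3`, Cossart–Piltant 2019 journal
Prop. 4.8 = arXiv v1 Prop. 4.6) follows from surface resolution over fields
(`CossartJannsenSaito2020`, used for the models of dimension `≤ 2` and the non-closed centres,
`ArithmeticalThreefoldsClosedPoints.lean`) together with the geometric head of the printed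
proof for the local rings `A = B_𝔭` (`B` a domain of finite type over a field `k`, `𝔭` maximal,
`dim B = dim B_𝔭 = 3`), in the format of `cpLocalUniformization_of_head`, the head being allowed
to use the hypothesis `CossartPiltant2019LUComplete3` (in the source: "By assumption in this
proposition and proposition 4.6, theorem 1.1 holds for `X̂ = Spec Â`"; it applies to the formal
branches of `B_𝔭`, `CossartPiltant2019LUComplete3.cpLocalUniformization_of_surjective`). All the
commutative algebra of the printed proof after the construction of `𝒪_{Ŷ,ŷ}` and of the `g_j`
is thereby discharged. [cite: CossartPiltant2019, Props. 4.6 and 4.8 (arXiv v1: Props. 4.4 and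
4.6, pp. 50–53)] -/
theorem CossartPiltant2019LU3OfComplete.of_head (hCJS : CossartJannsenSaito2020.{u})
    (head : CossartPiltant2019LUComplete3.{u} →
      ∀ (k B : Type u) [Field k] [CommRing B] [IsDomain B] [Algebra k B] [Algebra.FiniteType k B]
        (p : Ideal B) [p.IsMaximal], ringKrullDim B = 3 →
        ringKrullDim (Localization.AtPrime p) = 3 →
      ∀ (K : Type u) [Field K] [Algebra (Localization.AtPrime p) K]
        [IsFractionRing (Localization.AtPrime p) K] (O : ValuationSubring K),
      (∀ x : Localization.AtPrime p, algebraMap _ K x ∈ O) →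
      (∀ x ∈ maximalIdeal (Localization.AtPrime p), O.valuation (algebraMap _ K x) < 1) →
      (∀ y : O, ∃ q : Polynomial (Localization.AtPrime p),
        (∃ i, q.coeff i ∉ maximalIdeal (Localization.AtPrime p)) ∧
        O.valuation (q.eval₂ (algebraMap _ K) y) < 1) →
      ∀ (K₁ : Type u) [Field K₁]
        [Algebra (AdicCompletion (maximalIdeal (Localization.AtPrime p))
          (Localization.AtPrime p)) K₁],
      RingHom.ker (algebraMap (AdicCompletion (maximalIdeal (Localization.AtPrime p))
          (Localization.AtPrime p)) K₁) ∈
        minimalPrimes (AdicCompletion (maximalIdeal (Localization.AtPrime p))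
          (Localization.AtPrime p)) →
      (∀ z : K₁, ∃ a b : AdicCompletion (maximalIdeal (Localization.AtPrime p))
          (Localization.AtPrime p), z = algebraMap _ K₁ a / algebraMap _ K₁ b) →
      ∀ (ι : K →+* K₁), ι.comp (algebraMap (Localization.AtPrime p) K) =
        (algebraMap (AdicCompletion (maximalIdeal (Localization.AtPrime p))
          (Localization.AtPrime p)) K₁).comp (algebraMap (Localization.AtPrime p) _) →
      ∀ (O' : ValuationSubring K₁),
      (∀ x : AdicCompletion (maximalIdeal (Localization.AtPrime p)) (Localization.AtPrime p),
        algebraMap _ K₁ x ∈ O') →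
      (∀ x ∈ (maximalIdeal (Localization.AtPrime p)).map (algebraMap (Localization.AtPrime p)
          (AdicCompletion (maximalIdeal (Localization.AtPrime p)) (Localization.AtPrime p))),
        O'.valuation (algebraMap _ K₁ x) < 1) →
      (∀ y : O', ∃ q : Polynomial (AdicCompletion (maximalIdeal (Localization.AtPrime p))
          (Localization.AtPrime p)),
        (∃ i, q.coeff i ∉ (maximalIdeal (Localization.AtPrime p)).map
          (algebraMap (Localization.AtPrime p)
            (AdicCompletion (maximalIdeal (Localization.AtPrime p)) (Localization.AtPrime p)))) ∧
        O'.valuation (q.eval₂ (algebraMap _ K₁) y) < 1) →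
      O'.comap ι = O →
      ∃ (S : Type u) (_ : CommRing S) (_ : IsRegularLocalRing S)
        (_ : Algebra (AdicCompletion (maximalIdeal (Localization.AtPrime p))
          (Localization.AtPrime p)) S) (_ : Algebra S K₁),
        IsLocalHom (algebraMap (AdicCompletion (maximalIdeal (Localization.AtPrime p))
          (Localization.AtPrime p)) S) ∧
        Algebra.EssFiniteType (AdicCompletion (maximalIdeal (Localization.AtPrime p))
          (Localization.AtPrime p)) S ∧
        IsScalarTower (AdicCompletion (maximalIdeal (Localization.AtPrime p))
          (Localization.AtPrime p)) S K₁ ∧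
        Function.Injective (algebraMap S K₁) ∧
        (∀ s : S, algebraMap S K₁ s ∈ O') ∧
        (∀ s ∈ maximalIdeal S, O'.valuation (algebraMap S K₁ s) < 1) ∧
        ∃ (d : ℕ) (z : Fin d → S) (a : Fin d → ℕ) (c : Fin d → Sˣ) (g : Fin d → K),
          Ideal.span (Set.range z) = maximalIdeal S ∧ (∀ j, 0 < a j) ∧
          ∀ j, ι (g j) = algebraMap S K₁ (c j * z j ^ a j)) :
    CossartPiltant2019LU3OfComplete.{u} :=
  CossartPiltant2019LU3OfComplete.of_closedPoints hCJS fun hc k B _ _ _ _ _ p _ h1 h2 => by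
    haveI : IsNoetherianRing B := Algebra.FiniteType.isNoetherianRing k B
    haveI : IsNoetherianRing (Localization.AtPrime p) :=
      IsLocalization.isNoetherianRing p.primeCompl _ inferInstance
    exact cpLocalUniformization_of_head k (head hc k B p h1 h2)

end Literature.AlgebraicGeometry.Resolution

end
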